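import Literature.AnabelianGeometry.SemiGraphs.ArithQuasiGeometricSurjective
import Literature.AnabelianGeometry.SemiGraphs.ArithIntersectionWithGeometricProofs
import Literature.AnabelianGeometry.SemiGraphs.ArithEdgeLikeInfVerticial
import HarnessLib

/-!
# [SemiAnbd] Theorem 5.4 (iii), clause 1 under the COMPATIBLE reading — the arithmetic R0′: `B^temp(φ)`
# satisfies the compatibility clause (row T54-7c, binder `h1c` of the umbrella v3b; proof-only)

Mochizuki, *Semi-graphs of anabelioids*, Publ. RIMS **42** (2006), §5, Theorem 5.4 (iii), manuscript
p. 66 [cite: MochizukiSemiAnbd2006, Thm 5.4 (iii), p. 66] ("Applying `B^temp(−)` determines a natural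
bijective correspondence … the proofs are entirely parallel to those of Theorem 3.7, Corollary 3.9") and
§3, Cor. 3.9, proof, p. 42 ("whose quasi-geometricity follows by 'substituting' the equivalences of
Theorem 3.7, (iv), into Definition 3.8").

PROOF-ONLY (cell abc-iut, layer L3, row T54-7c = FINDING W4d083-F2 repair, seat abc-iut-w4-d083; no
definition).  Under the COMPATIBLE reading of "arithmetically quasi-geometric"
(`IsArithCompatiblyQuasiGeometric`, `ArithQuasiGeometricCompat.lean`) clause 1 of Thm 5.4 (iii) asks MORE
than print: `B^temp(φ)` must carry two distinct arithmetically maximal compact subgroups `K₁ ≠ H₁` with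
arithmetically ample intersection INTO two distinct arithmetically maximal compact subgroups, respectively
— the binder `h1c` of abc-iut-w5-d141's umbrella v3b.  `Thm54iii.h1c_of_iota` derives it, over the data of
p. 65 on both sides, from: Thm 5.4 (ii) on both sides (`hIIG`, `hIIH`); the commensurator description
(`hcommV`, `hcommV'`: `Π^temp_{𝔊,v}` is the commensurator of its geometric part); total elevation of the
geometric edge groups (`hEgeom`: `Π^temp_{𝔾,b} ≠ 1`); the tie `B^temp(φ)|_{Ker} = conj ∘ ι φ.geom`
(`hιbtemp`, as in the umbrella); continuity of `augH'`; and ONE datum about `ι g = B^temp(g)|_{geom}`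
symmetric to the umbrella's `hιgeomV` / `hιgeomE`, namely its kernel-level COMPATIBILITY shadow `hιgeomC`
(two distinct geometric verticial subgroups meeting non-trivially are mapped ONTO OPEN subgroups of two
DISTINCT geometric verticial subgroups, respectively) — producer-side this is the geometric R0′
`isCompatiblyQuasiGeometric_of_compatAt` (abc-iut-w4-d083) + `host_eq_of_mapsOnto` through the tempered
chart.  Route (the arithmetic translation of R0′): `K₁ ∩ H₁` is edge-like (Thm 5.4 (ii)), so the geometric
parts of `K₁`, `H₁` are distinct (commensurator description) and meet non-trivially (total elevation);
`hιgeomC` gives distinct geometric targets `T₁ ≠ T₂` with `ι g` open onto them; `B^temp(φ)(K₁ ∩ Ker)` =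
a conjugate of that open image, so its COMMENSURATOR is the conjugate verticial subgroup `K₂ ⊇ T₁`, which
contains `B^temp(φ)(K₁)` because `K₁` normalises `K₁ ∩ Ker`; `K₂ ≠ H₂` as their geometric parts are
conjugates of `T₁ ≠ T₂`.  Nothing asserted for real tempered data; nothing here bears on [IUTchIII]
Cor. 3.12; typed ≠ proved.
-/

namespace Literature.AnabelianGeometry.SemiGraphs

open _root_.CategoryTheory
open scoped Pointwise

universe u v w uG uH uP uV uB uV' uB'

/-! ### Group-theoretic bookkeeping -/

section GroupTheory

variable {Gtp : Type uG} [Group Gtp]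

/-- The `ConjAct`-translate of a subgroup is its conjugate (local copy of abc-iut-w4-d040's private
lemma). [folklore] -/
private theorem conjAct_smul_eq_conjSubgroup' (g : Gtp) (K : Subgroup Gtp) :
    ConjAct.toConjAct g • K = conjSubgroup g K := by
  ext x
  rw [Subgroup.mem_pointwise_smul_iff_inv_smul_mem]
  constructor
  · intro hx
    refine ⟨(ConjAct.toConjAct g)⁻¹ • x, hx, ?_⟩
    rw [← map_inv, ConjAct.smul_def, ConjAct.ofConjAct_toConjAct]
    simp [MulAut.conj_apply, mul_assoc]
  · rintro ⟨y, hy, rfl⟩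
    rw [← map_inv, ConjAct.smul_def, ConjAct.ofConjAct_toConjAct]
    simpa [MulAut.conj_apply, mul_assoc] using hy

/-- Conjugating a subgroup by one of its own elements does nothing. [folklore] -/
private theorem conjSubgroup_eq_self_of_mem {K : Subgroup Gtp} {k : Gtp} (hk : k ∈ K) :
    conjSubgroup k K = K := by
  ext x
  constructor
  · rintro ⟨y, hy, rfl⟩
    simpa [MulAut.conj_apply] using K.mul_mem (K.mul_mem hk hy) (K.inv_mem hk)
  · intro hx
    refine ⟨k⁻¹ * x * k, K.mul_mem (K.mul_mem (K.inv_mem hk) hx) hk, ?_⟩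
    simp [MulAut.conj_apply, mul_assoc]

/-- An element normalising `U` commensurates it. [folklore] -/
private theorem mem_commensurator_of_conj_eq {U : Subgroup Gtp} {g : Gtp} (h : conjSubgroup g U = U) :
    g ∈ Subgroup.Commensurable.commensurator U := by
  rw [Subgroup.Commensurable.commensurator_mem_iff, conjAct_smul_eq_conjSubgroup', h]

end GroupTheory

/-! ### The arithmetic R0′ -/

section Main

variable {Obj : Type u} [Category.{v} Obj] {𝓥 : SemiAnbdVocab.{u, v, w} Obj}
variable {𝔊 ℍ : ArithSemiGraph 𝓥} {e : 𝔊.PA ≃* ℍ.PA}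
variable {Gtp : Type uG} [Group Gtp] [TopologicalSpace Gtp]
variable {Htp : Type uH} [Group Htp] [TopologicalSpace Htp] [IsTopologicalGroup Htp]
variable {V : Type uV} {B : Type uB} {V' : Type uV'} {B' : Type uB'}
variable {D : DecompositionData Gtp V B} {D' : DecompositionData Htp V' B'}

/-- **The arithmetic R0′ — clause 1 of Thm 5.4 (iii) under the compatible reading (binder `h1c` of the
umbrella v3b).**  For every locally open `φ : 𝔊 → ℍ` over `A`, `B^temp(φ)` carries two distinct
arithmetically maximal compact subgroups `K₁ ≠ H₁` of `Π^temp_𝔊` with arithmetically ample `K₁ ∩ H₁` INTO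
two distinct arithmetically maximal compact subgroups `K₂ ≠ H₂` of `Π^temp_ℍ`, respectively.  Inputs
(inline shapes, nothing asserted): Thm 5.4 (ii) on both sides; the commensurator description on both
sides; total elevation of the geometric edge groups of `𝔊` (`hEgeom`); continuity of `augH'`; the tie
`hιbtemp`; and the kernel-level COMPATIBILITY shadow `hιgeomC` of `ι g` (producer-side: the geometric R0′
`isCompatiblyQuasiGeometric_of_compatAt` + `host_eq_of_mapsOnto` through the chart) — the one datum the
literal per-vertex / per-branch shadows cannot supply (the "fold", finding W4d083-F2).
[cite: MochizukiSemiAnbd2006, Thm 5.4 (iii), p. 66] -/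
theorem Thm54iii.h1c_of_iota (augG : Gtp →* 𝔊.PA) (augH' : Htp →* 𝔊.PA)
    (btemp : (φ : ArithHom 𝓥 𝔊 ℍ) → φ.IsLocallyOpen → ArithHom.IsOverA 𝔊 ℍ e φ → (Gtp →* Htp))
    (hIIG : ArithMaximalCompactStatementII D augG) (hIIH : ArithMaximalCompactStatementII D' augH')
    (haugH : Continuous augH')
    (hcommV : ∀ v : V, Subgroup.Commensurable.commensurator (D.vertGp v ⊓ augG.ker) = D.vertGp v)
    (hcommV' : ∀ w : V', Subgroup.Commensurable.commensurator (D'.vertGp w ⊓ augH'.ker) = D'.vertGp w)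
    (hEgeom : ∀ (b : B) (y : Gtp), conjSubgroup y (D.brGp b) ⊓ augG.ker ≠ ⊥)
    (ι : (𝔊.G ⟶ ℍ.G) → (augG.ker →* Htp))
    (hιbtemp : ∀ (φ : ArithHom 𝓥 𝔊 ℍ) (h₁ : φ.IsLocallyOpen) (h₂ : ArithHom.IsOverA 𝔊 ℍ e φ),
      ∃ δ ∈ augH'.ker, ∀ x : augG.ker, btemp φ h₁ h₂ x = δ * ι φ.geom x * δ⁻¹)
    (hιgeomC : ∀ (φ : ArithHom 𝓥 𝔊 ℍ), φ.IsLocallyOpen → ∀ (v₁ v₂ : V) (γ₁ γ₂ : Gtp),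
      conjSubgroup γ₁ (D.vertGp v₁) ⊓ augG.ker ≠ conjSubgroup γ₂ (D.vertGp v₂) ⊓ augG.ker →
      conjSubgroup γ₁ (D.vertGp v₁) ⊓ conjSubgroup γ₂ (D.vertGp v₂) ⊓ augG.ker ≠ ⊥ →
        ∃ (w₁ w₂ : V') (x₁ x₂ : Htp),
          conjSubgroup x₁ (D'.vertGp w₁) ⊓ augH'.ker ≠ conjSubgroup x₂ (D'.vertGp w₂) ⊓ augH'.ker ∧
          MapsOntoOpenSubgroupOf (ι φ.geom) ((conjSubgroup γ₁ (D.vertGp v₁) ⊓ augG.ker).subgroupOf augG.ker)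
            (conjSubgroup x₁ (D'.vertGp w₁) ⊓ augH'.ker) ∧
          MapsOntoOpenSubgroupOf (ι φ.geom) ((conjSubgroup γ₂ (D.vertGp v₂) ⊓ augG.ker).subgroupOf augG.ker)
            (conjSubgroup x₂ (D'.vertGp w₂) ⊓ augH'.ker)) :
    ∀ (φ : ArithHom 𝓥 𝔊 ℍ) (h₁ : φ.IsLocallyOpen) (h₂ : ArithHom.IsOverA 𝔊 ℍ e φ),
      ∀ K₁ H₁ : Subgroup Gtp, IsArithMaximalCompact augG K₁ → IsArithMaximalCompact augG H₁ →
        K₁ ≠ H₁ → IsArithAmple augG (K₁ ⊓ H₁) →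
          ∃ K₂ H₂ : Subgroup Htp, IsArithMaximalCompact augH' K₂ ∧ IsArithMaximalCompact augH' H₂ ∧
            K₂ ≠ H₂ ∧ K₁.map (btemp φ h₁ h₂) ≤ K₂ ∧ H₁.map (btemp φ h₁ h₂) ≤ H₂ := by
  intro φ h₁ h₂ K₁ H₁ hK₁ hH₁ hne hamp
  classical
  -- the source pair: verticial representatives (Thm 5.4 (ii))
  obtain ⟨v₁, γ₁, rfl⟩ := (hIIG.1 K₁).mp hK₁
  obtain ⟨v₂, γ₂, rfl⟩ := (hIIG.1 H₁).mp hH₁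
  -- their geometric parts are distinct (commensurator description) …
  have hneg : conjSubgroup γ₁ (D.vertGp v₁) ⊓ augG.ker ≠ conjSubgroup γ₂ (D.vertGp v₂) ⊓ augG.ker :=
    fun h => hne (isVerticial_eq_of_inf_ker_eq D augG hcommV ⟨v₁, γ₁, rfl⟩ ⟨v₂, γ₂, rfl⟩ h)
  -- … and meet non-trivially: `K₁ ∩ H₁` is edge-like (Thm 5.4 (ii)), edge groups are non-trivial
  have hmeet : conjSubgroup γ₁ (D.vertGp v₁) ⊓ conjSubgroup γ₂ (D.vertGp v₂) ⊓ augG.ker ≠ ⊥ := by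
    obtain ⟨b, y, hy⟩ := (hIIG.2 _).mp ⟨hamp, _, _, hK₁, hH₁, hne, rfl⟩
    rw [hy]
    exact hEgeom b y
  -- the kernel-level compatibility shadow of `ι φ.geom`
  obtain ⟨w₁, w₂, x₁, x₂, hTne, hm₁, hm₂⟩ := hιgeomC φ h₁ v₁ v₂ γ₁ γ₂ hneg hmeet
  obtain ⟨δ, hδ, hbt⟩ := hιbtemp φ h₁ h₂
  set f := btemp φ h₁ h₂ with hf
  -- geometric parts of the target representatives are compact
  haveI : augH'.ker.Normal := MonoidHom.normal_ker augH'
  have hker_closed : IsClosed (augH'.ker : Set Htp) := by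
    have : (augH'.ker : Set Htp) = augH' ⁻¹' {1} := by ext; simp [MonoidHom.mem_ker]
    rw [this]
    exact (isClosed_singleton).preimage haugH
  have hTc : ∀ (w : V') (x : Htp), IsCompact ((conjSubgroup x (D'.vertGp w) ⊓ augH'.ker : Subgroup Htp) : Set Htp) :=
    fun w x => by
      rw [Subgroup.coe_inf]
      exact ((hIIH.1 _).mpr ⟨w, x, rfl⟩).1.inter_right hker_closed
  -- MAIN STEP, for one member of the pair
  have key : ∀ (v : V) (γ : Gtp) (w : V') (x : Htp),
      MapsOntoOpenSubgroupOf (ι φ.geom) ((conjSubgroup γ (D.vertGp v) ⊓ augG.ker).subgroupOf augG.ker)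
        (conjSubgroup x (D'.vertGp w) ⊓ augH'.ker) →
      (conjSubgroup γ (D.vertGp v)).map f ≤ conjSubgroup (δ * x) (D'.vertGp w) := by
    intro v γ w x hm
    -- notation
    set K : Subgroup Gtp := conjSubgroup γ (D.vertGp v) with hKdef
    set T : Subgroup Htp := conjSubgroup x (D'.vertGp w) ⊓ augH'.ker with hTdef
    set U₀ : Subgroup Htp := ((K ⊓ augG.ker).subgroupOf augG.ker).map (ι φ.geom) with hU₀def
    -- `U₀` is commensurable with `T` (open image in a compact group)
    have hU₀T : U₀ ≤ T := hm.1
    have hidx : U₀.relIndex T ≠ 0 := by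
      haveI : CompactSpace T := isCompact_iff_compactSpace.mp (hTc w x)
      have hopen : IsOpen (((U₀.subgroupOf T : Subgroup T)) : Set T) := hm.2
      haveI := Subgroup.quotient_finite_of_isOpen _ hopen
      exact Subgroup.index_ne_zero_of_finite
    have hcomm : Subgroup.Commensurable U₀ T :=
      ⟨hidx, by rw [Subgroup.relIndex_eq_one.mpr hU₀T]; exact one_ne_zero⟩
    -- `f (K ∩ Ker) = δ · U₀ · δ⁻¹`
    have hU : (K ⊓ augG.ker).map f = conjSubgroup δ U₀ := by
      ext z
      constructor
      · rintro ⟨k, hk, rfl⟩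
        refine ⟨ι φ.geom ⟨k, hk.2⟩, ⟨⟨k, hk.2⟩, Subgroup.mem_subgroupOf.mpr hk, rfl⟩, ?_⟩
        rw [MulEquiv.coe_toMonoidHom, MulAut.conj_apply, hf, hbt ⟨k, hk.2⟩]
      · rintro ⟨_, ⟨k, hk, rfl⟩, rfl⟩
        refine ⟨(k : Gtp), Subgroup.mem_subgroupOf.mp hk, ?_⟩
        rw [MulEquiv.coe_toMonoidHom, MulAut.conj_apply, hf, hbt k]
    -- the commensurator of `f (K ∩ Ker)` is the verticial subgroup `(δx) · Π^temp_{ℍ,w} · (δx)⁻¹`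
    have hCU : Subgroup.Commensurable.commensurator ((K ⊓ augG.ker).map f) =
        conjSubgroup (δ * x) (D'.vertGp w) := by
      rw [hU, commensurator_conjSubgroup, hcomm.eq, hTdef,
        commensurator_inf_ker_eq_of_isVerticial D' augH' hcommV' ⟨w, x, rfl⟩, conjSubgroup_mul]
    -- `f(K)` normalises `f (K ∩ Ker)`, hence lies in its commensurator
    rw [← hCU]
    rintro _ ⟨k, hk, rfl⟩
    apply mem_commensurator_of_conj_eq
    have hKk : conjSubgroup k K = K := conjSubgroup_eq_self_of_mem hk
    calc conjSubgroup (f k) ((K ⊓ augG.ker).map f)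
        = ((K ⊓ augG.ker).map (MulAut.conj k).toMonoidHom).map f := by
          rw [conjSubgroup, Subgroup.map_map, Subgroup.map_map]
          congr 1
          ext y
          simp [MulAut.conj_apply]
      _ = (K ⊓ augG.ker).map f := by
          haveI : augG.ker.Normal := MonoidHom.normal_ker augG
          rw [show (K ⊓ augG.ker).map (MulAut.conj k).toMonoidHom = conjSubgroup k (K ⊓ augG.ker)
            from rfl, conjSubgroup_inf_of_normal, hKk]
  -- the targets
  refine ⟨conjSubgroup (δ * x₁) (D'.vertGp w₁), conjSubgroup (δ * x₂) (D'.vertGp w₂),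
    (hIIH.1 _).mpr ⟨w₁, δ * x₁, rfl⟩, (hIIH.1 _).mpr ⟨w₂, δ * x₂, rfl⟩, ?_,
    key v₁ γ₁ w₁ x₁ hm₁, key v₂ γ₂ w₂ x₂ hm₂⟩
  -- distinct: their geometric parts are `δ · Tᵢ · δ⁻¹` with `T₁ ≠ T₂`
  intro hEq
  apply hTne
  apply conjSubgroup_injective δ
  have h := congrArg (fun S : Subgroup Htp => S ⊓ augH'.ker) hEq
  rwa [conjSubgroup_mul, conjSubgroup_mul,
    ← conjSubgroup_inf_of_normal δ (conjSubgroup x₁ (D'.vertGp w₁)) augH'.ker,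
    ← conjSubgroup_inf_of_normal δ (conjSubgroup x₂ (D'.vertGp w₂)) augH'.ker] at h

end Main

end Literature.AnabelianGeometry.SemiGraphs
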